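import Mathlib
import Summits.ValiantsHypothesis.ValiantsHypothesis.Theorems.RigidityForcesSymmetryRankRigidMinimalReprLaplaceFiveStarWedgePoly

/-!
# ValiantsHypothesis / RigidityForcesSymmetry — crux `LaplaceOptimalFive` (stmt-ValiantsHypothesis-24813), crux idea
`young-shadow` (K1) on the star: **(L1) ENTRY POINT — A SQUAREFREE CUBIC DIVISIBLE BY A LINEAR FORM**
(memo `NOTE-p4g15-24813-K1-star.md` §10 «RESTRICTION BOUND: dim D_ℓ = 6, 3, 1, 0, 0»; memo `NOTE-p4g16-24813-LemmaK-kernel.md` §2 (L1))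

The rank bound (L1) `rank(Hess m + E) ≥ 8` starts from: restricting to `ℓ = 0` kills the T1-slack `E` (every entry divisible by `ℓ`),
so a linear relation among the entries of `Hess m + E` is a combination `F = Σ α_P x^P` of SQUAREFREE cubic monomials divisible by
`L = Σ λ_z X_z`.  This file computes what that forces (`squarefree_of_linForm_mul`): writing `F = L·G`,

* `coeff(X_i²) G = 0` for every `i` as soon as some `λ_z ≠ 0`,
* `coeff(X_i X_j) G = 0` whenever `λ_i ≠ 0` or `λ_j ≠ 0` (`i ≠ j`),

i.e. the quadratic part of `G` is supported on `{X_j X_k : λ_j = λ_k = 0}` — the space `D_ℓ` of the memo has dimension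
`C(5 − |supp λ|, 2) ∈ {6,3,1,0,0}`.  Corollary `squarefree_dvd_linForm_eq_zero`: if at least FOUR `λ_z` are non-zero, no non-zero
squarefree cubic form is divisible by `L` (restriction rank `10`).

Tool: `coeff_linForm_mul` (`coeff_m(L·G) = Σ_z λ_z [z ∈ supp m] coeff_{m−e_z} G`).  Pure algebra; no definitions, no `sorry`.
Honest framing: first brick of (L1) only; K1-on-the-star PAPER PASS, not kernel; `LaplaceOptimalFive` OPEN · CONTESTED 72/120;
`VP ≠ VNP` NOT proved.
-/

set_option linter.dupNamespace false

namespace Summit.ValiantsHypothesis.ValiantsHypothesis.Theorems.RigidityForcesSymmetryRankRigidMinimalRepr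

namespace LaplaceFiveStar

open Finset MvPolynomial

/-- Coefficients of `L·G` for a linear form `L = Σ λ_z X_z`:  `coeff_m(L·G) = Σ_z λ_z·[z ∈ supp m]·coeff_{m − e_z}(G)`. [folklore] -/
theorem coeff_linForm_mul (lam : Fin 5 → ℂ) (G : MvPolynomial (Fin 5) ℂ) (m : Fin 5 →₀ ℕ) :
    coeff m ((∑ z : Fin 5, lam z • (X z : MvPolynomial (Fin 5) ℂ)) * G)
      = ∑ z : Fin 5, lam z * (if z ∈ m.support then coeff (m - Finsupp.single z 1) G else 0) := by
  classical
  rw [Finset.sum_mul, coeff_sum]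
  refine Finset.sum_congr rfl fun z _ => ?_
  rw [smul_mul_assoc, coeff_smul, coeff_X_mul', smul_eq_mul]

/-- **A squarefree cubic divisible by a linear form.**  If `F = L·G` with `L = Σ λ_z X_z` and `F` has no monomials `X_i³`,
`X_i²X_j`, then `coeff(X_i²) G = 0` for all `i` (given some `λ_{z₀} ≠ 0`) and `coeff(X_iX_j) G = 0` whenever `λ_i ≠ 0`. [folklore] -/
theorem squarefree_of_linForm_mul (lam : Fin 5 → ℂ) (z₀ : Fin 5) (hz₀ : lam z₀ ≠ 0) (F G : MvPolynomial (Fin 5) ℂ)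
    (hF3 : ∀ i : Fin 5, coeff (Finsupp.single i 3) F = 0)
    (hF21 : ∀ i j : Fin 5, i ≠ j → coeff (Finsupp.single i 2 + Finsupp.single j 1) F = 0)
    (h : F = (∑ z : Fin 5, lam z • (X z : MvPolynomial (Fin 5) ℂ)) * G) :
    (∀ i : Fin 5, coeff (Finsupp.single i 2) G = 0) ∧
    (∀ i j : Fin 5, i ≠ j → lam i ≠ 0 → coeff (Finsupp.single i 1 + Finsupp.single j 1) G = 0) := by
  classical
  -- the cube coefficient: `λ_i · coeff(X_i²) G = 0`
  have cube : ∀ i : Fin 5, lam i * coeff (Finsupp.single i 2) G = 0 := by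
    intro i
    have hc := hF3 i
    rw [h, coeff_linForm_mul, Finset.sum_eq_single i] at hc
    · have hs : i ∈ (Finsupp.single i 3).support := by simp
      rw [if_pos hs] at hc
      have e : Finsupp.single i 3 - Finsupp.single i 1 = Finsupp.single i 2 := by
        ext k
        simp only [Finsupp.tsub_apply, Finsupp.single_apply]
        split_ifs <;> rfl
      rwa [e] at hc
    · intro z _ hz
      have hzs : z ∉ (Finsupp.single i 3).support := by
        rw [Finsupp.support_single _ (by norm_num)]
        simpa using hz
      rw [if_neg hzs, mul_zero]
    · intro hi
      exact absurd (Finset.mem_univ i) hi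
  -- the `X_i² X_j` coefficient: `λ_i · coeff(X_iX_j) G + λ_j · coeff(X_i²) G = 0`
  have mixed : ∀ i j : Fin 5, i ≠ j →
      lam i * coeff (Finsupp.single i 1 + Finsupp.single j 1) G + lam j * coeff (Finsupp.single i 2) G = 0 := by
    intro i j hij
    have hc := hF21 i j hij
    rw [h, coeff_linForm_mul] at hc
    have hsupp : ∀ z : Fin 5, z ∈ (Finsupp.single i 2 + Finsupp.single j 1).support ↔ z = i ∨ z = j := by
      intro z
      rw [Finsupp.mem_support_iff, Finsupp.add_apply, Finsupp.single_apply, Finsupp.single_apply]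
      constructor
      · intro hz
        by_contra hne
        simp only [not_or] at hne
        rw [if_neg (Ne.symm hne.1), if_neg (Ne.symm hne.2)] at hz
        exact hz rfl
      · rintro (rfl | rfl)
        · simp
        · simp
    have e1 : Finsupp.single i 2 + Finsupp.single j 1 - Finsupp.single i 1 = Finsupp.single i 1 + Finsupp.single j 1 := by
      ext k
      simp only [Finsupp.tsub_apply, Finsupp.add_apply, Finsupp.single_apply]
      split_ifs <;> omega
    have e2 : Finsupp.single i 2 + Finsupp.single j 1 - Finsupp.single j 1 = Finsupp.single i 2 := by
      ext k
      simp only [Finsupp.tsub_apply, Finsupp.add_apply, Finsupp.single_apply]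
      split_ifs <;> omega
    have hterm : ∀ z : Fin 5, lam z * (if z ∈ (Finsupp.single i 2 + Finsupp.single j 1).support then
        coeff (Finsupp.single i 2 + Finsupp.single j 1 - Finsupp.single z 1) G else 0)
        = (if z = i then lam i * coeff (Finsupp.single i 1 + Finsupp.single j 1) G else 0)
          + (if z = j then lam j * coeff (Finsupp.single i 2) G else 0) := by
      intro z
      by_cases hzi : z = i
      · subst hzi
        rw [if_pos ((hsupp z).mpr (Or.inl rfl)), if_pos rfl, if_neg hij, e1, add_zero]
      · by_cases hzj : z = j
        · subst hzj
          rw [if_pos ((hsupp z).mpr (Or.inr rfl)), if_neg hzi, if_pos rfl, e2, zero_add]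
        · rw [if_neg (fun hm => by rcases (hsupp z).mp hm with h' | h' <;> contradiction), if_neg hzi, if_neg hzj,
            mul_zero, add_zero]
    rw [Finset.sum_congr rfl fun z _ => hterm z, Finset.sum_add_distrib, Finset.sum_ite_eq', Finset.sum_ite_eq',
      if_pos (Finset.mem_univ _), if_pos (Finset.mem_univ _)] at hc
    exact hc
  -- conclusions
  have diag : ∀ i : Fin 5, coeff (Finsupp.single i 2) G = 0 := by
    intro i
    by_cases hi : lam i = 0
    · by_cases hiz : i = z₀
      · subst hiz; exact absurd hi hz₀
      -- use the `X_i² X_{z₀}` coefficient: `λ_i c(X_iX_{z₀}) + λ_{z₀} c(X_i²) = λ_{z₀} c(X_i²)`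
      have hm := mixed i z₀ hiz
      rw [hi, zero_mul, zero_add] at hm
      exact (mul_eq_zero.mp hm).resolve_left hz₀
    · exact (mul_eq_zero.mp (cube i)).resolve_left hi
  refine ⟨diag, fun i j hij hi => ?_⟩
  have hm := mixed i j hij
  rw [diag i, mul_zero, add_zero] at hm
  exact (mul_eq_zero.mp hm).resolve_left hi

/-- The quadratic form of `G` then only sees the zero set of `λ`: `coeff(X_iX_j) G = 0` unless `λ_i = λ_j = 0`. [folklore] -/
theorem squarefree_of_linForm_mul' (lam : Fin 5 → ℂ) (z₀ : Fin 5) (hz₀ : lam z₀ ≠ 0) (F G : MvPolynomial (Fin 5) ℂ)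
    (hF3 : ∀ i : Fin 5, coeff (Finsupp.single i 3) F = 0)
    (hF21 : ∀ i j : Fin 5, i ≠ j → coeff (Finsupp.single i 2 + Finsupp.single j 1) F = 0)
    (h : F = (∑ z : Fin 5, lam z • (X z : MvPolynomial (Fin 5) ℂ)) * G) (i j : Fin 5) (hij : i ≠ j)
    (hl : lam i ≠ 0 ∨ lam j ≠ 0) : coeff (Finsupp.single i 1 + Finsupp.single j 1) G = 0 := by
  obtain ⟨-, hmix⟩ := squarefree_of_linForm_mul lam z₀ hz₀ F G hF3 hF21 h
  rcases hl with hl | hl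
  · exact hmix i j hij hl
  · rw [add_comm]; exact hmix j i (Ne.symm hij) hl

/-- **Restriction rank `10` for large support.**  If `F = L·G` is a squarefree cubic FORM (`G` a quadratic form) and at least four
of the `λ_z` are non-zero (at most one vanishes), then `G = 0` and `F = 0`. [folklore] -/
theorem squarefree_dvd_linForm_eq_zero (lam : Fin 5 → ℂ) (hbig : ∀ i j : Fin 5, i ≠ j → lam i ≠ 0 ∨ lam j ≠ 0)
    (F G : MvPolynomial (Fin 5) ℂ) (hG : G.IsHomogeneous 2)
    (hF3 : ∀ i : Fin 5, coeff (Finsupp.single i 3) F = 0)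
    (hF21 : ∀ i j : Fin 5, i ≠ j → coeff (Finsupp.single i 2 + Finsupp.single j 1) F = 0)
    (h : F = (∑ z : Fin 5, lam z • (X z : MvPolynomial (Fin 5) ℂ)) * G) : F = 0 := by
  classical
  -- some `λ_{z₀} ≠ 0`
  obtain ⟨z₀, hz₀⟩ : ∃ z₀ : Fin 5, lam z₀ ≠ 0 := by
    rcases hbig 0 1 (by decide) with h0 | h1
    · exact ⟨0, h0⟩
    · exact ⟨1, h1⟩
  obtain ⟨hdiag, -⟩ := squarefree_of_linForm_mul lam z₀ hz₀ F G hF3 hF21 h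
  have hoff := squarefree_of_linForm_mul' lam z₀ hz₀ F G hF3 hF21 h
  -- every degree-2 coefficient of `G` vanishes
  have hG0 : G = 0 := by
    ext d
    rw [coeff_zero]
    by_cases hd : d.degree = 2
    · -- `d` is `2e_i` or `e_i + e_j`
      have hsum : ∑ k : Fin 5, d k = 2 := by
        rw [← hd, Finsupp.degree_eq_sum]
      -- enumerate: find the shape of `d`
      have hle : ∀ k, d k ≤ 2 := fun k => by
        have := Finset.single_le_sum (fun k _ => Nat.zero_le (d k)) (Finset.mem_univ k)
        omega
      by_cases h2 : ∃ i, d i = 2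
      · obtain ⟨i, hi⟩ := h2
        have hd' : d = Finsupp.single i 2 := by
          ext k
          by_cases hk : k = i
          · subst hk; simp [hi]
          · rw [Finsupp.single_eq_of_ne hk]
            have h1 : d k + d i ≤ ∑ k : Fin 5, d k := by
              rw [← Finset.sum_pair hk]
              exact Finset.sum_le_sum_of_subset_of_nonneg (Finset.subset_univ _) fun _ _ _ => Nat.zero_le _
            omega
        rw [hd']; exact hdiag i
      · -- two distinct indices with value 1
        simp only [not_exists] at h2
        have hle1 : ∀ k, d k ≤ 1 := fun k => by have := hle k; have := h2 k; omega
        obtain ⟨i, hi⟩ : ∃ i, d i = 1 := by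
          by_contra hn
          simp only [not_exists] at hn
          have : ∀ k, d k = 0 := fun k => by have := hle1 k; have := hn k; omega
          simp [this] at hsum
        obtain ⟨j, hji, hj⟩ : ∃ j, j ≠ i ∧ d j = 1 := by
          by_contra hn
          simp only [not_exists, not_and] at hn
          have hrest : ∀ k, k ≠ i → d k = 0 := fun k hk => by have := hle1 k; have := hn k hk; omega
          have : ∑ k : Fin 5, d k = d i := Finset.sum_eq_single i (fun k _ hk => hrest k hk) (by simp)
          omega
        have hd' : d = Finsupp.single i 1 + Finsupp.single j 1 := by
          ext k
          rw [Finsupp.add_apply, Finsupp.single_apply, Finsupp.single_apply]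
          by_cases hki : i = k
          · subst hki; simp [hi, hji]
          · by_cases hkj : j = k
            · subst hkj; simp [hj, hki]
            · rw [if_neg hki, if_neg hkj]
              have h3 : d k + d i + d j ≤ ∑ k : Fin 5, d k := by
                have hsub : ({k, i, j} : Finset (Fin 5)) ⊆ Finset.univ := Finset.subset_univ _
                have := Finset.sum_le_sum_of_subset_of_nonneg hsub (f := fun k => d k) fun _ _ _ => Nat.zero_le _
                rw [Finset.sum_insert (by simp [Ne.symm hki, Ne.symm hkj]), Finset.sum_pair (Ne.symm hji)] at this
                simpa [add_assoc] using this
              omega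
        rw [hd']
        exact hoff i j (Ne.symm hji) (hbig i j (Ne.symm hji))
    · exact hG.coeff_eq_zero hd
  rw [h, hG0, mul_zero]

end LaplaceFiveStar

end Summit.ValiantsHypothesis.ValiantsHypothesis.Theorems.RigidityForcesSymmetryRankRigidMinimalRepr
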